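import Summits.QuantumFields.BalabanUV.T4Continuum.Support.ShellMeasureLinearizedReal

/-!
# `T4Continuum.ShellMeasureLinearizedRealChart` — (LR)_j: row S33's CURVED-CHART HYPOTHESES BY ONE CALL from print's
# complex substitution + a real structure: a MEASURABLE real chart `Φ`, injective on the real window `ball 0 ε`, with
# a real Fréchet derivative within the window, linearizing the real average, `‖D̃ B‖ ≤ 4C₂‖B‖²`
(cell `pub-balaban`, sub-cell `t4`, spine estimate NE7c (node U5b); row-NE7c OWNER lineage `b2b-balaban-t4-ne7c-p1`
(gen 27), leaf SM-L5 = (LR)_j under RULING T-NE7c-8; ADDITIVE — imports the owner's row S35 `ShellMeasureLinearizedReal`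
(p217010) only; modifies nothing; 0 `def`, 0 `def … : Prop`, 0 sorry, 0 citation of our own)

HONEST FRAMING.  Finite four-torus programme, rung (B)+1 only — NOT infinite volume, NOT a mass gap, NOT the Clay
problem, NOT summit progress; (B), `BetaPertHyp`, (B^μ) are not consumed.  NE7c (`T4IndicatorShell.ShellWeightBound`)
is NOT PRINTED and NOT PROVED; «NE7c ⇐ the named binders» (trigger c3).  [folklore] functional analysis + Borel
measurability of a piecewise-continuous map; print's device ([Balaban1987RG1] p. 267) enters only through the tree
leaves `B12Lineariz267` / `B12LinearizAnalytic267` via row S35; nothing printed is asserted.  HONEST DEPENDENCY (cell,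
verbatim): continuum YM on T⁴ ⇐ BetaPertH ∧ nine spine estimates (0/9 proved); BetaPertH ⇐ (D1) ∧ (D4) ∧ CAP+tail;
G-an2-4 gates asym, D1 and NE2/3/4.

THE POINT.  Row S33 file 1 `ShellMeasureLinearizedChart.slotAC_linearizedWindow_of_levelData` (and file 2
`ShellMeasureLinearizedConstraint`) take the curved chart per exterior point as DATA: a measurable window `O`, a
MEASURABLE map `Φ : E → E` injective on `O` with `HasFDerivWithinAt Φ (Φ' y) O y`, and (file 1 §3 / file 4) the
linearization `hlin`.  Row S35 (`ShellMeasureLinearizedReal.exists_realDt_ball`) produced from print's COMPLEX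
substitution + a real structure the real `D̃` with its fixed-point equation, bound and real derivative on the window
`ball 0 ε`.  This file closes the last gap between the two: the substitution `B ↦ B − hD̃(B)` is a priori defined
(and differentiable) only ON the window; S33 wants a globally MEASURABLE `Φ`.  §1 `exists_realChart`: extend by the
identity off the window (`(ball 0 ε).piecewise (B ↦ B − hD̃(B)) id`) — continuous on the open window (from the real
derivative) and on its complement, hence Borel measurable (`ContinuousOn.measurable_piecewise`); ON the window it IS
the substitution, so injectivity (`ShellMeasureLinearizedConstraint.substitution_injOn`), the derivative `id − h ∘ DD̃ᵣ`
(`…substitution_hasFDerivWithinAt`, transported by `HasFDerivWithinAt.congr'`) and the linearization identity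
(`B12Lineariz267.linearizes` over `ℝ`) hold there verbatim.  OUTPUT = exactly S33 f1's `hO`/`hΦm`/`hinj`/`hΦ'` (+
`hlin`, + the quadratic bound), for ONE exterior point; S33 allows the data to vary measurably with the exterior point
`z`, which for exterior-independent complex data is this file applied constantly in `z`.
WHAT REMAINS DISPLAYED (c3): as row S35 — that Bałaban's block average IS `LQ̃ + C̃` with `C̃` quadratic-analytic in
the contraction regime and real on real fields (B12 p. 267 / [15] Sect. C TYPE); [dict]; E2′'s SM-L1…L6.  No estimate.
-/

noncomputable section

open Set Metric Function

namespace Summit.QuantumFields.BalabanUV.T4Continuum.ShellMeasureLinearizedRealChart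

open Literature.MathematicalPhysics.QuantumFieldTheory.Balaban1983to89
open B13Contraction113 (QuadAnalytic)
open ShellMeasureLinearizedReal (exists_realDt)

variable {𝒳 𝒴 : Type*} [NormedAddCommGroup 𝒳] [NormedSpace ℂ 𝒳] [CompleteSpace 𝒳]
  [NormedAddCommGroup 𝒴] [NormedSpace ℂ 𝒴] [CompleteSpace 𝒴]
variable {E F : Type*} [NormedAddCommGroup E] [NormedSpace ℝ E] [MeasurableSpace E] [BorelSpace E]
  [NormedAddCommGroup F] [NormedSpace ℝ F]
variable {hop : 𝒳 →ₗ[ℂ] 𝒴} {Ct : 𝒴 → 𝒳} {C₂ R b ε : ℝ}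
  {jE : E →L[ℝ] 𝒴} {jF : F →L[ℝ] 𝒳} {pF : 𝒳 →L[ℝ] F} {h : F →L[ℝ] E} {Ctr : E → F}

/-- **ROW S33's CURVED-CHART HYPOTHESES BY ONE CALL.**  From the COMPLEX hypotheses of `B12Lineariz267.exists_Dt` /
`B12LinearizAnalytic267` (complex Banach `𝒴`, `𝒳`; `QuadAnalytic C̃ C₂ R`, `C̃` analytic on `‖Y‖ < R`;
`‖hX‖ ≤ b‖X‖`; `9C₂bε < 1`, `3ε ≤ R`) and a NORM-PRESERVING REAL STRUCTURE (`jE`, `jF` isometric inclusions, `pF` a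
retraction of `jF`, real `h`, `Ctr` intertwined with `h`, `C̃`) and a real `L` with `L (h x) = x` («LQ̃h = I» on real
fields): there are a real `D̃ᵣ : E → F`, a chart `Φ : E → E` and derivatives `Φ' : E → E →L[ℝ] E` such that
(1) `Φ` is MEASURABLE (S33 f1 `hΦm`); (2) `Φ` is injective on `ball 0 ε` (`hinj`; `hO` = `measurableSet_ball`);
(3) `HasFDerivWithinAt Φ (Φ' B) (ball 0 ε) B` on the window (`hΦ'`); (4) ON the window `Φ B = B − h (D̃ᵣ B)`;
(5) the real fixed-point equation `Ctr (B − h (D̃ᵣ B)) = D̃ᵣ B`; (6) the linearization `L (Φ B) + Ctr (Φ B) = L B`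
(S33's `hlin` with `Q̃ = L + C̃`); (7) `‖D̃ᵣ B‖ ≤ 4C₂‖B‖²`; (8) `Φ' B = id − h ∘L (pF ∘L D.restrictScalars ℝ ∘L jE)` for
a continuous COMPLEX-linear `D` (print's «I − h(δ/δB)D̃», real form).  CONDITIONAL on every hypothesis; nothing
printed asserted. [folklore] -/
theorem exists_realChart (hCq : QuadAnalytic Ct C₂ R) (hCa : AnalyticOnNhd ℂ Ct {Y : 𝒴 | ‖Y‖ < R})
    (hC₂ : 0 ≤ C₂) (hb : 0 ≤ b) (hHop : ∀ X, ‖hop X‖ ≤ b * ‖X‖) (hq : 9 * C₂ * b * ε < 1) (hRC : 3 * ε ≤ R)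
    (hpF : ∀ x, pF (jF x) = x) (hh : ∀ x, hop (jF x) = jE (h x)) (hC : ∀ y, Ct (jE y) = jF (Ctr y))
    (hjE : ∀ B, ‖jE B‖ = ‖B‖) (hjF : ∀ x, ‖jF x‖ = ‖x‖) (L : E →L[ℝ] F) (hLh : ∀ x, L (h x) = x) :
    ∃ (Dtr : E → F) (Φ : E → E) (Φ' : E → E →L[ℝ] E),
      Measurable Φ ∧ InjOn Φ (ball (0 : E) ε) ∧
      (∀ B ∈ ball (0 : E) ε, HasFDerivWithinAt Φ (Φ' B) (ball (0 : E) ε) B) ∧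
      (∀ B ∈ ball (0 : E) ε, Φ B = B - h (Dtr B)) ∧
      (∀ B ∈ ball (0 : E) ε, Ctr (B - h (Dtr B)) = Dtr B) ∧
      (∀ B ∈ ball (0 : E) ε, L (Φ B) + Ctr (Φ B) = L B) ∧
      (∀ B ∈ ball (0 : E) ε, ‖Dtr B‖ ≤ 4 * C₂ * ‖B‖ ^ 2) ∧
      (∀ B ∈ ball (0 : E) ε, ∃ D : 𝒴 →L[ℂ] 𝒳,
        Φ' B = ContinuousLinearMap.id ℝ E - h.comp (pF ∘L D.restrictScalars ℝ ∘L jE)) := by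
  classical
  obtain ⟨Dtr, hDtr⟩ :=
    ShellMeasureLinearizedReal.exists_realDt_ball hCq hCa hC₂ hb hHop hq hRC hpF hh hC hjE hjF
  -- the substitution on the window and its data
  have hfix : ∀ B ∈ ball (0 : E) ε, Ctr (B - h (Dtr B)) = Dtr B := fun B hB =>
    (hDtr B (mem_ball_zero_iff.mp hB)).1
  have hbd : ∀ B ∈ ball (0 : E) ε, ‖Dtr B‖ ≤ 4 * C₂ * ‖B‖ ^ 2 := fun B hB =>
    (hDtr B (mem_ball_zero_iff.mp hB)).2.1
  -- a choice of the complex derivative per window point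
  have hD : ∀ B : E, ∃ D : 𝒴 →L[ℂ] 𝒳, B ∈ ball (0 : E) ε →
      HasFDerivWithinAt Dtr (pF ∘L D.restrictScalars ℝ ∘L jE) (ball (0 : E) ε) B := by
    intro B
    by_cases hB : B ∈ ball (0 : E) ε
    · obtain ⟨-, -, D, hD⟩ := hDtr B (mem_ball_zero_iff.mp hB)
      exact ⟨D, fun _ => hD⟩
    · exact ⟨0, fun hB' => absurd hB' hB⟩
  choose D hD using hD
  -- continuity of `Dtr`, hence of the substitution, ON the window
  have hcont : ContinuousOn Dtr (ball (0 : E) ε) := fun B hB => (hD B hB).continuousWithinAt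
  set Φs : E → E := fun B => B - h (Dtr B) with hΦs
  have hΦs_cont : ContinuousOn Φs (ball (0 : E) ε) :=
    continuousOn_id.sub (h.continuous.comp_continuousOn hcont)
  set Φ : E → E := (ball (0 : E) ε).piecewise Φs id with hΦ
  have hΦ_eq : EqOn Φ Φs (ball (0 : E) ε) := fun B hB => piecewise_eq_of_mem _ _ _ hB
  refine ⟨Dtr, Φ, fun B => ContinuousLinearMap.id ℝ E - h.comp (pF ∘L (D B).restrictScalars ℝ ∘L jE),
    ?_, ?_, ?_, ?_, hfix, ?_, hbd, fun B _ => ⟨D B, rfl⟩⟩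
  · -- (1) measurable: continuous on the window and on its complement
    exact hΦs_cont.measurable_piecewise continuousOn_id measurableSet_ball
  · -- (2) injective on the window
    exact (ShellMeasureLinearizedConstraint.substitution_injOn h Ctr Dtr hfix).congr hΦ_eq.symm
  · -- (3) the derivative within the window
    intro B hB
    exact (ShellMeasureLinearizedConstraint.substitution_hasFDerivWithinAt h Dtr (hD B hB)).congr' hΦ_eq hB
  · -- (4) on the window `Φ` is the substitution
    exact fun B hB => hΦ_eq hB
  · -- (6) linearization of the real average
    intro B hB
    rw [hΦ_eq hB]
    exact B12Lineariz267.linearizes (LQ := (L : E →ₗ[ℝ] F)) (hop := (h : F →ₗ[ℝ] E)) (Ct := Ctr) hLh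
      (hfix B hB)

end Summit.QuantumFields.BalabanUV.T4Continuum.ShellMeasureLinearizedRealChart

end
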